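import Literature.Analysis.OperatorTheory.HermitianKernelOperator
import Literature.Analysis.OperatorTheory.PositiveKernelTransferOperator
import HarnessLib

/-!
# ENGINE-KL layer (K4a) for `SqueezedSkewness.TorusKL` (stmt-QuantumFields-23204, stub `stub_torusMixtureData`):
# COMPLEXIFICATION OF REAL `L²` — the embedding `J : L²(X;ℝ) → L²(X;ℂ)`, real and imaginary parts, and the transfer of
# real kernel operators to complex scalars

The Källén–Lehmann data of `stub_torusMixtureData` live on a COMPLEX Hilbert space (`ℓ²(ℕ, ℂ)`), while the transfer-matrix
trace formulas of the tree (`PositiveKernelSpectralTrace*`, `FinTorusWindow`, `…TorusKLSiteTraces`) are stated on `Lp ℝ 2 μ`.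
This file is the bridge (generic measure space `X`, measure `μ`):
* §1 `J = ofReal ∘ ·`, `Re`, `Im` as real-linear bounded maps between `Lp ℝ 2 μ` and `Lp ℂ 2 μ`; `Re ∘ J = id`, `Im ∘ J = 0`,
  `g = J (Re g) + i • J (Im g)`; `⟪J f, J g⟫_ℂ = ⟪f, g⟫_ℝ`, `‖J f‖ = ‖f‖`;
* §2 a complex-linear operator on `Lp ℂ 2 μ` is determined by its values on `J(Lp ℝ 2 μ)` (`eq_of_comp_ofRealLp`), and products
  of complexified operators are complexified products;
* §3 for a real bounded measurable kernel `k`: the complex operator `T'` with `T' g =ᵐ ∫ k(·,y) g(y)` satisfies `T' (J f) = J (T f)`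
  for the real operator `T` of `k` (`kernelOp_complex_ofRealLp`), hence `Re (T' g) = T (Re g)`, `Im (T' g) = T (Im g)`, and
  `⟪T' g, g⟫_ℂ ≥ 0` whenever the real form `⟪T f, f⟫_ℝ ≥ 0` is non-negative and `k` symmetric (`re_inner_kernelOp_complex_nonneg`).
Mathlib + `HermitianKernelOperator` ∕ `PositiveKernelTransferOperator` only; theorems only (`J`, `Re`, `Im` are the Mathlib maps
`Complex.ofRealCLM.compLpL`, `Complex.reCLM.compLpL`, `Complex.imCLM.compLpL`, written out).  [folklore]  Seat `ym-line-fcl-p3` g16.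
References: M. Reed, B. Simon, *Methods of Modern Mathematical Physics I* (1980), §VI.6 [cite: ReedSimonI1980, Thm VI.23].
-/

set_option autoImplicit false

noncomputable section

open MeasureTheory Filter Function
open scoped InnerProductSpace ComplexConjugate ENNReal

namespace Summit.QuantumFields.YangMills.Theorems.TorusKL.ComplexBridge

variable {X : Type*} [MeasurableSpace X] {μ : Measure X}

/-! ## §1 `J = ofReal ∘ ·`, real and imaginary parts -/

/-- `(J f)(x) = f(x)` as a complex number, a.e. [folklore] -/
theorem coeFn_ofRealLp (f : Lp ℝ 2 μ) :
    ((Complex.ofRealCLM.compLpL 2 μ f : Lp ℂ 2 μ) : X → ℂ) =ᵐ[μ] fun x => ((f x : ℝ) : ℂ) :=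
  Complex.ofRealCLM.coeFn_compLpL f

/-- `(Re g)(x) = Re (g x)` a.e. [folklore] -/
theorem coeFn_reLp (g : Lp ℂ 2 μ) : ((Complex.reCLM.compLpL 2 μ g : Lp ℝ 2 μ) : X → ℝ) =ᵐ[μ] fun x => (g x).re :=
  Complex.reCLM.coeFn_compLpL g

/-- `(Im g)(x) = Im (g x)` a.e. [folklore] -/
theorem coeFn_imLp (g : Lp ℂ 2 μ) : ((Complex.imCLM.compLpL 2 μ g : Lp ℝ 2 μ) : X → ℝ) =ᵐ[μ] fun x => (g x).im :=
  Complex.imCLM.coeFn_compLpL g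

/-- `Re (J f) = f`. [folklore] -/
theorem reLp_ofRealLp (f : Lp ℝ 2 μ) : Complex.reCLM.compLpL 2 μ (Complex.ofRealCLM.compLpL 2 μ f) = f := by
  refine Lp.ext ((coeFn_reLp _).trans ?_)
  filter_upwards [coeFn_ofRealLp f] with x hx
  rw [hx, Complex.ofReal_re]

/-- `Im (J f) = 0`. [folklore] -/
theorem imLp_ofRealLp (f : Lp ℝ 2 μ) : Complex.imCLM.compLpL 2 μ (Complex.ofRealCLM.compLpL 2 μ f) = 0 := by
  refine Lp.ext ((coeFn_imLp _).trans ?_)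
  filter_upwards [coeFn_ofRealLp f, Lp.coeFn_zero ℝ 2 μ] with x hx h0
  rw [hx, Complex.ofReal_im, h0, Pi.zero_apply]

/-- `Re (i • J f) = 0`. [folklore] -/
theorem reLp_I_smul_ofRealLp (f : Lp ℝ 2 μ) :
    Complex.reCLM.compLpL 2 μ (Complex.I • Complex.ofRealCLM.compLpL 2 μ f) = 0 := by
  refine Lp.ext ((coeFn_reLp _).trans ?_)
  filter_upwards [coeFn_ofRealLp f, Lp.coeFn_zero ℝ 2 μ, Lp.coeFn_smul Complex.I (Complex.ofRealCLM.compLpL 2 μ f)]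
    with x hx h0 hs
  rw [hs, Pi.smul_apply, hx, h0, Pi.zero_apply, smul_eq_mul, Complex.I_mul_re, Complex.ofReal_im, neg_zero]

/-- `Im (i • J f) = f`. [folklore] -/
theorem imLp_I_smul_ofRealLp (f : Lp ℝ 2 μ) :
    Complex.imCLM.compLpL 2 μ (Complex.I • Complex.ofRealCLM.compLpL 2 μ f) = f := by
  refine Lp.ext ((coeFn_imLp _).trans ?_)
  filter_upwards [coeFn_ofRealLp f, Lp.coeFn_smul Complex.I (Complex.ofRealCLM.compLpL 2 μ f)] with x hx hs
  rw [hs, Pi.smul_apply, hx, smul_eq_mul, Complex.I_mul_im, Complex.ofReal_re]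

/-- **`g = J (Re g) + i • J (Im g)`**. [folklore] -/
theorem ofRealLp_re_add_I_smul_ofRealLp_im (g : Lp ℂ 2 μ) :
    Complex.ofRealCLM.compLpL 2 μ (Complex.reCLM.compLpL 2 μ g) +
      Complex.I • Complex.ofRealCLM.compLpL 2 μ (Complex.imCLM.compLpL 2 μ g) = g := by
  refine Lp.ext ?_
  filter_upwards [Lp.coeFn_add (Complex.ofRealCLM.compLpL 2 μ (Complex.reCLM.compLpL 2 μ g))
      (Complex.I • Complex.ofRealCLM.compLpL 2 μ (Complex.imCLM.compLpL 2 μ g)),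
    Lp.coeFn_smul Complex.I (Complex.ofRealCLM.compLpL 2 μ (Complex.imCLM.compLpL 2 μ g)),
    coeFn_ofRealLp (Complex.reCLM.compLpL 2 μ g), coeFn_ofRealLp (Complex.imCLM.compLpL 2 μ g),
    coeFn_reLp g, coeFn_imLp g] with x hadd hs hre him hre' him'
  rw [hadd, Pi.add_apply, hs, Pi.smul_apply, hre, him, hre', him', smul_eq_mul, mul_comm]
  exact Complex.re_add_im (g x)

/-- **`⟪J f, J g⟫_ℂ = ⟪f, g⟫_ℝ`**. [folklore] -/
theorem inner_ofRealLp_ofRealLp (f g : Lp ℝ 2 μ) :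
    ⟪(Complex.ofRealCLM.compLpL 2 μ f : Lp ℂ 2 μ), Complex.ofRealCLM.compLpL 2 μ g⟫_ℂ = ((⟪f, g⟫_ℝ : ℝ) : ℂ) := by
  rw [L2.inner_def, L2.inner_def, ← integral_complex_ofReal]
  refine integral_congr_ae ?_
  filter_upwards [coeFn_ofRealLp f, coeFn_ofRealLp g] with x hf hg
  rw [hf, hg]
  simp only [RCLike.inner_apply', conj_trivial, Complex.ofReal_mul, Complex.conj_ofReal]

/-- `‖J f‖ = ‖f‖`. [folklore] -/
theorem norm_ofRealLp (f : Lp ℝ 2 μ) : ‖(Complex.ofRealCLM.compLpL 2 μ f : Lp ℂ 2 μ)‖ = ‖f‖ := by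
  have h := inner_ofRealLp_ofRealLp (μ := μ) f f
  rw [← sq_eq_sq₀ (norm_nonneg _) (norm_nonneg _)]
  have h1 : (‖(Complex.ofRealCLM.compLpL 2 μ f : Lp ℂ 2 μ)‖ ^ 2 : ℝ) =
      (⟪(Complex.ofRealCLM.compLpL 2 μ f : Lp ℂ 2 μ), Complex.ofRealCLM.compLpL 2 μ f⟫_ℂ).re := by
    rw [← inner_self_eq_norm_sq (𝕜 := ℂ)]; rfl
  rw [h1, h, Complex.ofReal_re, real_inner_self_eq_norm_sq]

/-- `J` of a real scalar multiple. [folklore] -/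
theorem ofRealLp_smul (c : ℝ) (f : Lp ℝ 2 μ) :
    Complex.ofRealCLM.compLpL 2 μ (c • f) = (c : ℂ) • Complex.ofRealCLM.compLpL 2 μ f := by
  refine Lp.ext ?_
  filter_upwards [coeFn_ofRealLp (c • f), coeFn_ofRealLp f, Lp.coeFn_smul c f,
    Lp.coeFn_smul (c : ℂ) (Complex.ofRealCLM.compLpL 2 μ f)] with x h1 h2 h3 h4
  rw [h1, h4, Pi.smul_apply, h2, h3, Pi.smul_apply, smul_eq_mul, smul_eq_mul, Complex.ofReal_mul]

/-! ## §2 Complex-linear operators are determined on `J(L²(X;ℝ))` -/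

/-- **A complex-linear bounded operator on `Lp ℂ 2 μ` is determined by its values on real functions.** [folklore] -/
theorem eq_of_comp_ofRealLp {T T' : Lp ℂ 2 μ →L[ℂ] Lp ℂ 2 μ}
    (h : ∀ f : Lp ℝ 2 μ, T (Complex.ofRealCLM.compLpL 2 μ f) = T' (Complex.ofRealCLM.compLpL 2 μ f)) : T = T' := by
  refine ContinuousLinearMap.ext fun g => ?_
  rw [← ofRealLp_re_add_I_smul_ofRealLp_im g, map_add, map_add, map_smul, map_smul, h, h]

/-- The action of a complex-linear operator in terms of its action on real functions. [folklore] -/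
theorem apply_eq_of_comp_ofRealLp {T : Lp ℂ 2 μ →L[ℂ] Lp ℂ 2 μ} {S : Lp ℝ 2 μ →L[ℝ] Lp ℝ 2 μ}
    (h : ∀ f : Lp ℝ 2 μ, T (Complex.ofRealCLM.compLpL 2 μ f) = Complex.ofRealCLM.compLpL 2 μ (S f)) (g : Lp ℂ 2 μ) :
    T g = Complex.ofRealCLM.compLpL 2 μ (S (Complex.reCLM.compLpL 2 μ g)) +
      Complex.I • Complex.ofRealCLM.compLpL 2 μ (S (Complex.imCLM.compLpL 2 μ g)) := by
  conv_lhs => rw [← ofRealLp_re_add_I_smul_ofRealLp_im g]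
  rw [map_add, map_smul, h, h]

/-- `Re (T g) = S (Re g)` for the complexification `T` of `S`. [folklore] -/
theorem reLp_apply_of_comp_ofRealLp {T : Lp ℂ 2 μ →L[ℂ] Lp ℂ 2 μ} {S : Lp ℝ 2 μ →L[ℝ] Lp ℝ 2 μ}
    (h : ∀ f : Lp ℝ 2 μ, T (Complex.ofRealCLM.compLpL 2 μ f) = Complex.ofRealCLM.compLpL 2 μ (S f)) (g : Lp ℂ 2 μ) :
    Complex.reCLM.compLpL 2 μ (T g) = S (Complex.reCLM.compLpL 2 μ g) := by
  rw [apply_eq_of_comp_ofRealLp h g, map_add, reLp_ofRealLp, reLp_I_smul_ofRealLp, add_zero]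

/-- `Im (T g) = S (Im g)` for the complexification `T` of `S`. [folklore] -/
theorem imLp_apply_of_comp_ofRealLp {T : Lp ℂ 2 μ →L[ℂ] Lp ℂ 2 μ} {S : Lp ℝ 2 μ →L[ℝ] Lp ℝ 2 μ}
    (h : ∀ f : Lp ℝ 2 μ, T (Complex.ofRealCLM.compLpL 2 μ f) = Complex.ofRealCLM.compLpL 2 μ (S f)) (g : Lp ℂ 2 μ) :
    Complex.imCLM.compLpL 2 μ (T g) = S (Complex.imCLM.compLpL 2 μ g) := by
  rw [apply_eq_of_comp_ofRealLp h g, map_add, imLp_ofRealLp, imLp_I_smul_ofRealLp, zero_add]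

/-- **Products of complexifications are complexifications of products.** [folklore] -/
theorem mul_comp_ofRealLp {T₁ T₂ : Lp ℂ 2 μ →L[ℂ] Lp ℂ 2 μ} {S₁ S₂ : Lp ℝ 2 μ →L[ℝ] Lp ℝ 2 μ}
    (h₁ : ∀ f : Lp ℝ 2 μ, T₁ (Complex.ofRealCLM.compLpL 2 μ f) = Complex.ofRealCLM.compLpL 2 μ (S₁ f))
    (h₂ : ∀ f : Lp ℝ 2 μ, T₂ (Complex.ofRealCLM.compLpL 2 μ f) = Complex.ofRealCLM.compLpL 2 μ (S₂ f)) (f : Lp ℝ 2 μ) :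
    (T₁ * T₂) (Complex.ofRealCLM.compLpL 2 μ f) = Complex.ofRealCLM.compLpL 2 μ ((S₁ * S₂) f) := by
  rw [mul_apply_eq_comp, mul_apply_eq_comp, h₂, h₁]

/-- `Re ((c : ℂ) • g) = c • Re g` for real `c`. [folklore] -/
theorem reLp_ofReal_smul (c : ℝ) (g : Lp ℂ 2 μ) :
    Complex.reCLM.compLpL 2 μ ((c : ℂ) • g) = c • Complex.reCLM.compLpL 2 μ g := by
  refine Lp.ext ?_
  filter_upwards [coeFn_reLp ((c : ℂ) • g), coeFn_reLp g, Lp.coeFn_smul (c : ℂ) g,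
    Lp.coeFn_smul c (Complex.reCLM.compLpL 2 μ g)] with x h1 h2 h3 h4
  rw [h1, h3, Pi.smul_apply, h4, Pi.smul_apply, h2, smul_eq_mul, smul_eq_mul, Complex.re_ofReal_mul]

/-- `Im ((c : ℂ) • g) = c • Im g` for real `c`. [folklore] -/
theorem imLp_ofReal_smul (c : ℝ) (g : Lp ℂ 2 μ) :
    Complex.imCLM.compLpL 2 μ ((c : ℂ) • g) = c • Complex.imCLM.compLpL 2 μ g := by
  refine Lp.ext ?_
  filter_upwards [coeFn_imLp ((c : ℂ) • g), coeFn_imLp g, Lp.coeFn_smul (c : ℂ) g,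
    Lp.coeFn_smul c (Complex.imCLM.compLpL 2 μ g)] with x h1 h2 h3 h4
  rw [h1, h3, Pi.smul_apply, h4, Pi.smul_apply, h2, smul_eq_mul, smul_eq_mul, Complex.im_ofReal_mul]

/-- **`J` of an orthonormal family is orthonormal.** [folklore] -/
theorem orthonormal_ofRealLp {ι : Type*} {v : ι → Lp ℝ 2 μ} (hv : Orthonormal ℝ v) :
    Orthonormal ℂ fun i => (Complex.ofRealCLM.compLpL 2 μ (v i) : Lp ℂ 2 μ) := by
  classical
  rw [orthonormal_iff_ite] at hv ⊢
  intro i j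
  rw [inner_ofRealLp_ofRealLp, hv i j]
  split_ifs <;> simp

/-! ## §3 Real kernel operators on complex `L²` -/

section Kernel

variable {k : X → X → ℝ} {C : ℝ}

/-- The complex-valued copy of a real jointly measurable kernel is jointly (strongly) measurable. [folklore] -/
theorem stronglyMeasurable_ofReal_kernel (hk : StronglyMeasurable (uncurry k)) :
    StronglyMeasurable (uncurry fun x y => ((k x y : ℝ) : ℂ)) := by
  have h : (uncurry fun x y => ((k x y : ℝ) : ℂ)) = (fun r : ℝ => (r : ℂ)) ∘ uncurry k := by
    funext z; rfl
  rw [h]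
  exact Complex.continuous_ofReal.comp_stronglyMeasurable hk

omit [MeasurableSpace X] in
/-- The complex-valued copy of a bounded real kernel is bounded. [folklore] -/
theorem norm_ofReal_kernel_le (hC : ∀ x y, ‖k x y‖ ≤ C) (x y : X) : ‖((k x y : ℝ) : ℂ)‖ ≤ C := by
  rw [Complex.norm_real]; exact hC x y

omit [MeasurableSpace X] in
/-- A real symmetric kernel is Hermitian as a complex kernel. [folklore] -/
theorem ofReal_kernel_hermitian (hsymm : ∀ x y, k x y = k y x) (x y : X) :
    ((k x y : ℝ) : ℂ) = conj ((k y x : ℝ) : ℂ) := by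
  rw [Complex.conj_ofReal, hsymm]

/-- ★ **The complex kernel operator extends the real one: `T' (J f) = J (T f)`.** [folklore] -/
theorem kernelOp_complex_ofRealLp (hk : StronglyMeasurable (uncurry k)) (hC : ∀ x y, ‖k x y‖ ≤ C)
    {T : Lp ℝ 2 μ →L[ℝ] Lp ℝ 2 μ} (hT : ∀ f, (T f : X → ℝ) =ᵐ[μ] fun x => ∫ y, k x y * f y ∂μ)
    {T' : Lp ℂ 2 μ →L[ℂ] Lp ℂ 2 μ} (hT' : ∀ g, (T' g : X → ℂ) =ᵐ[μ] fun x => ∫ y, ((k x y : ℝ) : ℂ) * g y ∂μ)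
    (f : Lp ℝ 2 μ) :
    T' (Complex.ofRealCLM.compLpL 2 μ f) = Complex.ofRealCLM.compLpL 2 μ (T f) := by
  have _ := hk; have _ := hC
  refine Lp.ext ((hT' _).trans ?_)
  have hJ := coeFn_ofRealLp (μ := μ) f
  have hR : ((Complex.ofRealCLM.compLpL 2 μ (T f) : Lp ℂ 2 μ) : X → ℂ) =ᵐ[μ]
      fun x => ((∫ y, k x y * f y ∂μ : ℝ) : ℂ) :=
    (coeFn_ofRealLp (T f)).trans ((hT f).mono fun x hx => by dsimp only; rw [hx])
  refine Filter.EventuallyEq.trans (Filter.Eventually.of_forall fun x => ?_) hR.symm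
  dsimp only
  rw [← integral_complex_ofReal]
  exact integral_congr_ae (hJ.mono fun y hy => by dsimp only; rw [hy, Complex.ofReal_mul])

/-- **Positivity transfers**: if the real form `⟪T f, f⟫_ℝ` is non-negative then so is `Re ⟪T' g, g⟫_ℂ`
(`T' g = J T (Re g) + i J T (Im g)`). [folklore] -/
theorem re_inner_kernelOp_complex_nonneg (hk : StronglyMeasurable (uncurry k)) (hC : ∀ x y, ‖k x y‖ ≤ C)
    {T : Lp ℝ 2 μ →L[ℝ] Lp ℝ 2 μ} (hT : ∀ f, (T f : X → ℝ) =ᵐ[μ] fun x => ∫ y, k x y * f y ∂μ)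
    {T' : Lp ℂ 2 μ →L[ℂ] Lp ℂ 2 μ} (hT' : ∀ g, (T' g : X → ℂ) =ᵐ[μ] fun x => ∫ y, ((k x y : ℝ) : ℂ) * g y ∂μ)
    (hpos : ∀ f : Lp ℝ 2 μ, 0 ≤ ⟪T f, f⟫_ℝ) (hsymm : ∀ f f' : Lp ℝ 2 μ, ⟪T f, f'⟫_ℝ = ⟪f, T f'⟫_ℝ) (g : Lp ℂ 2 μ) :
    0 ≤ RCLike.re ⟪T' g, g⟫_ℂ := by
  have h := kernelOp_complex_ofRealLp hk hC hT hT'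
  set a := Complex.reCLM.compLpL 2 μ g with ha
  set c := Complex.imCLM.compLpL 2 μ g with hc
  have hg : g = Complex.ofRealCLM.compLpL 2 μ a + Complex.I • Complex.ofRealCLM.compLpL 2 μ c :=
    (ofRealLp_re_add_I_smul_ofRealLp_im g).symm
  have hTg : T' g = Complex.ofRealCLM.compLpL 2 μ (T a) + Complex.I • Complex.ofRealCLM.compLpL 2 μ (T c) :=
    apply_eq_of_comp_ofRealLp h g
  rw [hTg]
  conv_rhs => rw [hg]
  simp only [inner_add_left, inner_add_right, inner_smul_left, inner_smul_right, inner_ofRealLp_ofRealLp,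
    Complex.conj_I]
  have h1 : ⟪T a, c⟫_ℝ = ⟪T c, a⟫_ℝ := by rw [hsymm, real_inner_comm]
  simp only [map_add, RCLike.re_to_complex, Complex.ofReal_re, Complex.mul_re, Complex.neg_re, Complex.neg_im,
    Complex.I_re, Complex.I_im, Complex.ofReal_im, Complex.add_re, Complex.add_im, Complex.mul_im, neg_mul, h1]
  nlinarith [hpos a, hpos c]

end Kernel

/-! ## §4 Composition (translation) operators on complex `L²` -/

/-- **The complex composition operator extends the real one**: if `U f =ᵐ f ∘ τ` on `Lp ℝ 2 μ` and `U' g =ᵐ g ∘ τ` on `Lp ℂ 2 μ`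
for a quasi-measure-preserving `τ`, then `U' (J f) = J (U f)`. [folklore] -/
theorem compOp_complex_ofRealLp {τ : X → X} (hτ : Measure.QuasiMeasurePreserving τ μ μ)
    {U : Lp ℝ 2 μ →L[ℝ] Lp ℝ 2 μ} (hU : ∀ f, (U f : X → ℝ) =ᵐ[μ] fun x => f (τ x))
    {U' : Lp ℂ 2 μ →L[ℂ] Lp ℂ 2 μ} (hU' : ∀ g, (U' g : X → ℂ) =ᵐ[μ] fun x => g (τ x)) (f : Lp ℝ 2 μ) :
    U' (Complex.ofRealCLM.compLpL 2 μ f) = Complex.ofRealCLM.compLpL 2 μ (U f) := by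
  refine Lp.ext ((hU' _).trans ?_)
  have h1 : (fun x => ((Complex.ofRealCLM.compLpL 2 μ f : Lp ℂ 2 μ) : X → ℂ) (τ x)) =ᵐ[μ]
      fun x => ((f (τ x) : ℝ) : ℂ) := hτ.ae_eq_comp (coeFn_ofRealLp f)
  have h2 : ((Complex.ofRealCLM.compLpL 2 μ (U f) : Lp ℂ 2 μ) : X → ℂ) =ᵐ[μ] fun x => ((f (τ x) : ℝ) : ℂ) :=
    (coeFn_ofRealLp (U f)).trans ((hU f).mono fun x hx => by show ((U f x : ℝ) : ℂ) = _; rw [hx])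
  exact h1.trans h2.symm

/-! ## §5 Eigenvectors of the complexified operator -/

section Eigen

variable {ι : Type*} {b : HilbertBasis ι ℝ (Lp ℝ 2 μ)} {lam : ι → ℝ} {T : Lp ℝ 2 μ →L[ℝ] Lp ℝ 2 μ}

/-- **Non-zero eigenvalues of a Hilbert–Schmidt family have finite multiplicity**: `Σ λᵢ² < ∞` ⇒ `{i : λᵢ = c}` is finite for
`c ≠ 0`. [folklore] -/
theorem finite_fibre (hS : Summable fun i => lam i ^ 2) {c : ℝ} (hc : c ≠ 0) : Set.Finite {i | lam i = c} := by
  have h := hS.tendsto_cofinite_zero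
  have hc2 : (0 : ℝ) < c ^ 2 := by positivity
  have hev : ∀ᶠ i in Filter.cofinite, lam i ^ 2 < c ^ 2 := h.eventually (gt_mem_nhds hc2)
  rw [Filter.eventually_cofinite] at hev
  refine hev.subset fun i hi => ?_
  simp only [Set.mem_setOf_eq] at hi ⊢
  rw [hi]; exact lt_irrefl _

/-- **A real eigenvector is a finite combination of the basis eigenvectors of its eigenvalue**: for self-adjoint `T` with
`T bᵢ = λᵢ bᵢ` and `T v = c v`, `v = Σ_{λᵢ = c} ⟪bᵢ, v⟫ bᵢ` (the other coefficients vanish). [folklore] -/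
theorem eq_sum_fibre_of_eigenvector (hb : ∀ i, T (b i) = lam i • b i) (hsa : ∀ f f' : Lp ℝ 2 μ, ⟪T f, f'⟫_ℝ = ⟪f, T f'⟫_ℝ)
    {c : ℝ} {s : Finset ι} (hs : ∀ i, lam i = c → i ∈ s) {v : Lp ℝ 2 μ} (hv : T v = c • v) :
    v = ∑ i ∈ s, ⟪b i, v⟫_ℝ • b i := by
  have hcoef : ∀ i, i ∉ s → ⟪b i, v⟫_ℝ = 0 := by
    intro i hi
    have hne : lam i ≠ c := fun h => hi (hs i h)
    have h1 : ⟪T (b i), v⟫_ℝ = lam i * ⟪b i, v⟫_ℝ := by rw [hb, real_inner_smul_left]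
    have h2 : ⟪T (b i), v⟫_ℝ = c * ⟪b i, v⟫_ℝ := by rw [hsa, hv, real_inner_smul_right]
    have h3 : (lam i - c) * ⟪b i, v⟫_ℝ = 0 := by rw [sub_mul, ← h1, ← h2, sub_self]
    rcases mul_eq_zero.1 h3 with h | h
    · exact absurd (sub_eq_zero.1 h) hne
    · exact h
  have hsum := b.hasSum_repr v
  have hsum' : HasSum (fun i => b.repr v i • b i) (∑ i ∈ s, ⟪b i, v⟫_ℝ • b i) := by
    have h : HasSum (fun i => b.repr v i • b i) (∑ i ∈ s, b.repr v i • b i) :=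
      hasSum_sum_of_ne_finset_zero (fun i hi => by rw [b.repr_apply_apply, hcoef i hi, zero_smul])
    simp only [b.repr_apply_apply] at h ⊢
    exact h
  exact hsum.unique hsum'

variable {k : X → X → ℝ} {C : ℝ}

/-- **`J bᵢ` is an eigenvector of the complexified kernel operator** with the same (real) eigenvalue. [folklore] -/
theorem kernelOp_complex_ofRealLp_basis (hk : StronglyMeasurable (uncurry k)) (hC : ∀ x y, ‖k x y‖ ≤ C)
    (hT : ∀ f, (T f : X → ℝ) =ᵐ[μ] fun x => ∫ y, k x y * f y ∂μ)
    {T' : Lp ℂ 2 μ →L[ℂ] Lp ℂ 2 μ} (hT' : ∀ g, (T' g : X → ℂ) =ᵐ[μ] fun x => ∫ y, ((k x y : ℝ) : ℂ) * g y ∂μ)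
    (hb : ∀ i, T (b i) = lam i • b i) (i : ι) :
    T' (Complex.ofRealCLM.compLpL 2 μ (b i)) = (lam i : ℂ) • Complex.ofRealCLM.compLpL 2 μ (b i) := by
  rw [kernelOp_complex_ofRealLp hk hC hT hT', hb, ofRealLp_smul]

/-- ★ **Complex eigenvectors lie in the complex span of the real basis eigenvectors of the same eigenvalue**: if
`T' g = c g` (`c` real) for the complexification `T'` of the self-adjoint `T`, then `g ∈ span_ℂ {J bᵢ : λᵢ = c}` (for any finite
`s ⊇ {λᵢ = c}`). [folklore] -/
theorem mem_span_fibre_of_eigenvector_complex (hk : StronglyMeasurable (uncurry k)) (hC : ∀ x y, ‖k x y‖ ≤ C)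
    (hT : ∀ f, (T f : X → ℝ) =ᵐ[μ] fun x => ∫ y, k x y * f y ∂μ)
    {T' : Lp ℂ 2 μ →L[ℂ] Lp ℂ 2 μ} (hT' : ∀ g, (T' g : X → ℂ) =ᵐ[μ] fun x => ∫ y, ((k x y : ℝ) : ℂ) * g y ∂μ)
    (hb : ∀ i, T (b i) = lam i • b i) (hsa : ∀ f f' : Lp ℝ 2 μ, ⟪T f, f'⟫_ℝ = ⟪f, T f'⟫_ℝ)
    {c : ℝ} {s : Finset ι} (hs : ∀ i, lam i = c → i ∈ s) {g : Lp ℂ 2 μ} (hg : T' g = (c : ℂ) • g) :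
    g ∈ Submodule.span ℂ (Set.range fun i : s => (Complex.ofRealCLM.compLpL 2 μ (b i) : Lp ℂ 2 μ)) := by
  have h := kernelOp_complex_ofRealLp hk hC hT hT'
  -- real and imaginary parts are real eigenvectors
  have hre : T (Complex.reCLM.compLpL 2 μ g) = c • Complex.reCLM.compLpL 2 μ g := by
    rw [← reLp_apply_of_comp_ofRealLp h g, hg, reLp_ofReal_smul]
  have him : T (Complex.imCLM.compLpL 2 μ g) = c • Complex.imCLM.compLpL 2 μ g := by
    rw [← imLp_apply_of_comp_ofRealLp h g, hg, imLp_ofReal_smul]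
  have hre' := eq_sum_fibre_of_eigenvector hb hsa hs hre
  have him' := eq_sum_fibre_of_eigenvector hb hsa hs him
  rw [← ofRealLp_re_add_I_smul_ofRealLp_im g, hre', him', map_sum, map_sum, Finset.smul_sum]
  refine Submodule.add_mem _ (Submodule.sum_mem _ fun i hi => ?_) (Submodule.sum_mem _ fun i hi => ?_)
  · rw [ofRealLp_smul]
    exact Submodule.smul_mem _ _ (Submodule.subset_span ⟨⟨i, hi⟩, rfl⟩)
  · rw [ofRealLp_smul, smul_smul]
    exact Submodule.smul_mem _ _ (Submodule.subset_span ⟨⟨i, hi⟩, rfl⟩)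

/-- Conversely the `J bᵢ`, `λᵢ = c`, are eigenvectors of `T'` for `c`, so the eigenspace of `T'` for a real `c` is EXACTLY
`span_ℂ {J bᵢ : λᵢ = c}` when `s = {λᵢ = c}`. [folklore] -/
theorem apply_eq_smul_of_mem_span_fibre (hk : StronglyMeasurable (uncurry k)) (hC : ∀ x y, ‖k x y‖ ≤ C)
    (hT : ∀ f, (T f : X → ℝ) =ᵐ[μ] fun x => ∫ y, k x y * f y ∂μ)
    {T' : Lp ℂ 2 μ →L[ℂ] Lp ℂ 2 μ} (hT' : ∀ g, (T' g : X → ℂ) =ᵐ[μ] fun x => ∫ y, ((k x y : ℝ) : ℂ) * g y ∂μ)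
    (hb : ∀ i, T (b i) = lam i • b i) {c : ℝ} {s : Finset ι} (hs : ∀ i ∈ s, lam i = c) {g : Lp ℂ 2 μ}
    (hg : g ∈ Submodule.span ℂ (Set.range fun i : s => (Complex.ofRealCLM.compLpL 2 μ (b i) : Lp ℂ 2 μ))) :
    T' g = (c : ℂ) • g := by
  refine Submodule.span_induction (p := fun g _ => T' g = (c : ℂ) • g) ?_ ?_ ?_ ?_ hg
  · rintro _ ⟨⟨i, hi⟩, rfl⟩
    rw [kernelOp_complex_ofRealLp_basis hk hC hT hT' hb, hs i hi]
  · simp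
  · intro x y _ _ hx hy; rw [map_add, hx, hy, smul_add]
  · intro a x _ hx; rw [map_smul, hx, smul_comm]

end Eigen

end Summit.QuantumFields.YangMills.Theorems.TorusKL.ComplexBridge

end
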